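/-
Copyright (c) 2026. All rights reserved.
Released under Apache 2.0 license as described in the file LICENSE.
Authors: abc-iut cell, F-wave prover seat abc-iut-f-101 (gen 4), over abc-iut-w6-d036's genuine mono-analytic base and
functorial containers (`MLFGaloisMonoAnabelianContainers.lean`), its canonical LCFT transport
(`MLFGaloisMonoAnabelianTransport.lean`) and part 1 (`MLFGaloisMonoAnabelianPerfectionCarriers.lean`).
-/
import Literature.AnabelianGeometry.AbsoluteAnabelian.AbsTopIII.MLFGaloisMonoAnabelianPerfectionCarriers
import HarnessLib

/-!
# [AbsTopIII] Prop 5.8 (ii)/(vii) AT THE GENUINE MONO-ANALYTIC BASE: the perfection vertices `k~(G)`, `(k̄^×(G))^pf` of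
# `Γ⃗×_non(G)` as FUNCTORIAL containers on `MonoBase`, and the three remaining edges as natural transformations

S. Mochizuki, *Topics in absolute anabelian geometry III: global reconstruction algorithms*, J. Math. Sci. Univ.
Tokyo 22 (2015) 939–1156 [MochizukiAbsTopIII2015]; locators = pages of the author's manuscript
(`paper:url-5493eb38cbb7`), read on the page: Def 3.1 (iv) p. 69 (`λ^{×pf}`, `ι_×`), Def 5.4 (iii) p. 126 (the
nonarchimedean graph `Γ⃗^log_v`: `𝒪^× ↪ k̄^×`, the shell-arrow `𝒪^× → k~`, `k̄^× → (k̄^×)^pf`, `k~ ↪ (k̄^×)^pf`), Prop 5.8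
(ii) p. 139 ("a functorial [i.e., relative to `TG⊢`] “group-theoretic” algorithm “`G ↦ Γ⃗×_non(G)`”"), Prop 5.8 (vii)
p. 141–142 (`ψ^{An⊢⊞}_{w,ν}` "for each vertex `ν` of `Γ⃗×_w`", `ι^{An⊢⊞}_{w,ε}` "for each edge `ε`").

## What this file builds (node [AbsTopIII] Prop 5.8 (vii), layer L4; L4-lead m88 row «PF-CARRIERS», part 2 of 2)

Over part 1 (`MLFGaloisMonoAnabelianPerfectionCarriers.lean`: carriers `TimesPf`, `UnitsPf`, the `TS`-pairs `timesPfObj`,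
`unitsPfObj` of mono-analytic type) and abc-iut-w6-d036's `kbarTimes` / `kbarUnits` / `homOfEquivariant` pattern verbatim:

* the canonical LCFT transport `β_α` descended to the perfections (`transportUnits`, `transportUnitGroup`,
  `transportTimesPf`, `transportUnitsPf`; `transport_refl` / `transport_trans` / `transport_smul` in units form);
* **the functors `MLFClosure.kbarTimesPf`, `MLFClosure.kbarUnitsPf : MonoBase ⥤ 𝒞_TS`** — `C ↦ (G_k ↷ (k̄^×)^pf)`,
  `C ↦ (G_k ↷ k~)`; on `α : G_{k₁} ⥲ G_{k₂}` (ANY isomorphism of topological Galois groups) the pair `(α, β_α mod μ)`;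
* **the three remaining edges of `Γ⃗×_non(G)` at container level**, natural on `MonoBase`:
  `kbarTimesToTimesPf : kbarTimes ⟶ kbarTimesPf` (`k̄^× → (k̄^×)^pf`), `kbarUnitsToUnitsPf : kbarUnits ⟶ kbarUnitsPf` (the
  shell-arrow `𝒪^× → k~` on the mono-analytic side), `kbarUnitsPfToTimesPf : kbarUnitsPf ⟶ kbarTimesPf` (`k~ ↪ (k̄^×)^pf`),
  all lying over the base ON THE NOSE (`pf_edges_homPi`), and the commuting square with abc-iut-w6-d036's `kbarUnitsToTimes`
  (`kbarUnits_pf_square`); summary `exists_genuine_pf_containers`.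

Consumers (by name, L4-lead m88): abc-iut-w4-d095's `ψ^{An⊢⊞}` at `k~`, `(k̄^×)^pf` and the genuine `ι^{An⊢⊞}` arrows
(`LogFrobeniusMonoGenuineProp58viiPf.lean`), and this seat's (d)-datum `η⊢_{v,ν}` of Cor 5.10 (iv)(c).
HONEST FRAMING: MODEL-LEVEL (one nonarchimedean place; arithmetic data discrete per Rmk 3.1.1); classical local class
field theory and the `p`-adic logarithm as proved in the tree; refereed pre-IUT material; nothing here bears on
[IUTchIII] Cor. 3.12; no side taken; typed ≠ proved.
-/

set_option autoImplicit false

noncomputable section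

namespace Literature.AnabelianGeometry.AbsoluteAnabelian

open CategoryTheory
open AbsTopIII
open scoped nonZeroDivisors

namespace MLFClosure

/-! ## Part 4. The canonical transport descended to the perfections -/

section Transport

variable {C₁ C₂ C₃ : MLFClosure.{0}}

/-- `β_α` on units of the field: `k̄₁^× ⥲ k̄₂^×`. [cite: MochizukiAbsTopIII2015, Prop 5.8 (ii) p. 139] -/
def transportUnits (α : (C₁.K ≃ₐ[C₁.k] C₁.K) ≃ₜ* (C₂.K ≃ₐ[C₂.k] C₂.K)) : (C₁.K)ˣ ≃* (C₂.K)ˣ :=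
  (unitsOfNonZero C₁).symm.trans ((transport α).trans (unitsOfNonZero C₂))

/-- `transportUnits` on values is the transport. [cite: MochizukiAbsTopIII2015, Prop 5.8 (ii) p. 139] -/
@[simp] theorem coe_transportUnits (α : (C₁.K ≃ₐ[C₁.k] C₁.K) ≃ₜ* (C₂.K ≃ₐ[C₂.k] C₂.K)) (u : (C₁.K)ˣ) :
    ((transportUnits α u : (C₂.K)ˣ) : C₂.K) = (transport α ((unitsOfNonZero C₁).symm u) : C₂.K) := rfl

/-- `β_α` carries `𝒪^×_{k̄₁}` onto `𝒪^×_{k̄₂}` (`transport_mem_unitSubmonoid_iff`), as a homomorphism of `unitGroup`s.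
[cite: MochizukiAbsTopIII2015, Prop 5.8 (ii) p. 139] -/
def transportUnitGroup (α : (C₁.K ≃ₐ[C₁.k] C₁.K) ≃ₜ* (C₂.K ≃ₐ[C₂.k] C₂.K)) :
    ↥(unitGroup C₁.k C₁.K) →* ↥(unitGroup C₂.k C₂.K) :=
  ((transportUnits α).toMonoidHom.comp (unitGroup C₁.k C₁.K).subtype).codRestrict _ fun u =>
    (mem_unitGroup_iff _).mpr ((transport_mem_unitSubmonoid_iff α ((unitsOfNonZero C₁).symm (u : (C₁.K)ˣ))).mp u.2)

/-- `transportUnitGroup` on values. [cite: MochizukiAbsTopIII2015, Prop 5.8 (ii) p. 139] -/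
@[simp] theorem coe_transportUnitGroup (α : (C₁.K ≃ₐ[C₁.k] C₁.K) ≃ₜ* (C₂.K ≃ₐ[C₂.k] C₂.K))
    (u : ↥(unitGroup C₁.k C₁.K)) :
    (((transportUnitGroup α u : ↥(unitGroup C₂.k C₂.K)) : (C₂.K)ˣ) : C₂.K) =
      (transport α ((unitsOfNonZero C₁).symm (u : (C₁.K)ˣ)) : C₂.K) := rfl

/-- **`β_α mod μ` on `(k̄^×)^pf`.** [cite: MochizukiAbsTopIII2015, Prop 5.8 (ii) p. 139] -/
def transportTimesPf (α : (C₁.K ≃ₐ[C₁.k] C₁.K) ≃ₜ* (C₂.K ≃ₐ[C₂.k] C₂.K)) : TimesPf C₁ →* TimesPf C₂ :=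
  QuotientGroup.map _ _ (transportUnits α).toMonoidHom (torsion_le_comap_of_monoidHom _)

/-- **`β_α mod μ` on `k~`.** [cite: MochizukiAbsTopIII2015, Prop 5.8 (ii) p. 139] -/
def transportUnitsPf (α : (C₁.K ≃ₐ[C₁.k] C₁.K) ≃ₜ* (C₂.K ≃ₐ[C₂.k] C₂.K)) : UnitsPf C₁ →* UnitsPf C₂ :=
  QuotientGroup.map _ _ (transportUnitGroup α) (torsion_le_comap_of_monoidHom _)

/-- `β_α mod μ` on a class of `(k̄^×)^pf`. [cite: MochizukiAbsTopIII2015, Prop 5.8 (ii) p. 139] -/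
@[simp] theorem transportTimesPf_mk (α : (C₁.K ≃ₐ[C₁.k] C₁.K) ≃ₜ* (C₂.K ≃ₐ[C₂.k] C₂.K)) (u : (C₁.K)ˣ) :
    transportTimesPf α (toTimesPf C₁ u) = toTimesPf C₂ (transportUnits α u) := rfl

/-- `β_α mod μ` on a class of `k~`. [cite: MochizukiAbsTopIII2015, Prop 5.8 (ii) p. 139] -/
@[simp] theorem transportUnitsPf_mk (α : (C₁.K ≃ₐ[C₁.k] C₁.K) ≃ₜ* (C₂.K ≃ₐ[C₂.k] C₂.K)) (u : ↥(unitGroup C₁.k C₁.K)) :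
    transportUnitsPf α (toUnitsPf C₁ u) = toUnitsPf C₂ (transportUnitGroup α u) := rfl

/-- `β_{refl}` is the identity on `k̄^×` (`transport_refl`). [cite: MochizukiAbsTopIII2015, Prop 5.8 (ii) p. 139] -/
theorem transportUnits_refl (C : MLFClosure.{0}) (u : (C.K)ˣ) :
    transportUnits (ContinuousMulEquiv.refl (C.K ≃ₐ[C.k] C.K)) u = u := by
  apply Units.ext
  rw [coe_transportUnits, transport_refl]
  rfl

/-- `β_{α ≫ γ} = β_γ ∘ β_α` on `k̄^×` (`transport_trans`). [cite: MochizukiAbsTopIII2015, Prop 5.8 (ii) p. 139] -/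
theorem transportUnits_trans (α : (C₁.K ≃ₐ[C₁.k] C₁.K) ≃ₜ* (C₂.K ≃ₐ[C₂.k] C₂.K))
    (γ : (C₂.K ≃ₐ[C₂.k] C₂.K) ≃ₜ* (C₃.K ≃ₐ[C₃.k] C₃.K)) (u : (C₁.K)ˣ) :
    transportUnits (α.trans γ) u = transportUnits γ (transportUnits α u) := by
  apply Units.ext
  rw [coe_transportUnits, coe_transportUnits, transport_trans]
  rfl

/-- `β_α` is `α`-equivariant on `k̄^×` (units form of `transport_smul`). [cite: MochizukiAbsTopIII2015, Prop 5.8 (ii) p. 139] -/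
theorem transportUnits_galUnitsHom (α : (C₁.K ≃ₐ[C₁.k] C₁.K) ≃ₜ* (C₂.K ≃ₐ[C₂.k] C₂.K))
    (σ : C₁.K ≃ₐ[C₁.k] C₁.K) (u : (C₁.K)ˣ) :
    transportUnits α (C₁.galUnitsHom σ u) = C₂.galUnitsHom (α σ) (transportUnits α u) := by
  apply Units.ext
  rw [coe_transportUnits, coe_galUnitsHom, coe_transportUnits, ← AlgEquiv.smul_def,
    ← transport_smul α σ ((unitsOfNonZero C₁).symm u)]
  rfl

end Transport

/-! ## Part 5. The functorial containers `G ↦ (G ↷ (k̄^×(G))^pf)`, `G ↦ (G ↷ k~(G))` on the mono-analytic base -/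

/-- **The functorial container `G ↦ (G ↷ (k̄^×(G))^pf)`** (Prop 5.8 (ii), vertex `(k̄^×)^pf`; the object/morphism part of
`ψ^{An⊢⊞}_{w,ν}` of Prop 5.8 (vii) at that vertex): `C ↦ (G_k ↷ (k̄^×)^pf)`, `α ↦ (α, β_α mod μ)`.
[cite: MochizukiAbsTopIII2015, Prop 5.8 (vii) p.141] -/
def kbarTimesPf : MonoBase ⥤ TSObj where
  obj C := timesPfObj C
  map {C₁ C₂} f := homOfEquivariant (timesPfObj_actionKer C₁) (timesPfObj_actionKer C₂) (timesPfObj_discreteTopology C₁)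
    (homIso f) (transportTimesPf (homIso f)) fun g x => by
      induction x using QuotientGroup.induction_on with
      | H u =>
        change transportTimesPf (homIso f) (toTimesPf C₁ (C₁.galUnitsHom g u)) =
          toTimesPf C₂ (C₂.galUnitsHom (homIso f g) (transportUnits (homIso f) u))
        rw [transportTimesPf_mk, transportUnits_galUnitsHom]
  map_id C := by
    refine TSObj.Hom.ext (MonoidHom.ext fun _ => rfl) (funext fun x => ?_)
    induction x using QuotientGroup.induction_on with
    | H u =>
      change transportTimesPf (ContinuousMulEquiv.refl _) (toTimesPf C u) = toTimesPf C u
      rw [transportTimesPf_mk, transportUnits_refl]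
  map_comp {C₁ C₂ C₃} f g := by
    refine TSObj.Hom.ext (MonoidHom.ext fun _ => rfl) (funext fun x => ?_)
    induction x using QuotientGroup.induction_on with
    | H u =>
      change transportTimesPf ((homIso f).trans (homIso g)) (toTimesPf C₁ u) =
        transportTimesPf (homIso g) (transportTimesPf (homIso f) (toTimesPf C₁ u))
      rw [transportTimesPf_mk, transportTimesPf_mk, transportTimesPf_mk, transportUnits_trans]

/-- **The functorial container `G ↦ (G ↷ k~(G))`, `k~ = (𝒪^×_k̄)^pf`** (Prop 5.8 (ii), vertex `k~`; `ψ^{An⊢⊞}_{w,ν}` of Prop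
5.8 (vii) at that vertex): `C ↦ (G_k ↷ 𝒪^×_k̄ ⧸ μ)`, `α ↦ (α, β_α mod μ)`. [cite: MochizukiAbsTopIII2015, Prop 5.8 (vii) p.141] -/
def kbarUnitsPf : MonoBase ⥤ TSObj where
  obj C := unitsPfObj C
  map {C₁ C₂} f := homOfEquivariant (unitsPfObj_actionKer C₁) (unitsPfObj_actionKer C₂) (unitsPfObj_discreteTopology C₁)
    (homIso f) (transportUnitsPf (homIso f)) fun g x => by
      induction x using QuotientGroup.induction_on with
      | H u =>
        change transportUnitsPf (homIso f) (toUnitsPf C₁ (C₁.galUnitGroupHom g u)) =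
          toUnitsPf C₂ (C₂.galUnitGroupHom (homIso f g) (transportUnitGroup (homIso f) u))
        rw [transportUnitsPf_mk]
        refine congrArg (toUnitsPf C₂) (Subtype.ext ?_)
        change transportUnits (homIso f) (C₁.galUnitsHom g (u : (C₁.K)ˣ)) =
          C₂.galUnitsHom (homIso f g) (transportUnits (homIso f) (u : (C₁.K)ˣ))
        exact transportUnits_galUnitsHom (homIso f) g u
  map_id C := by
    refine TSObj.Hom.ext (MonoidHom.ext fun _ => rfl) (funext fun x => ?_)
    induction x using QuotientGroup.induction_on with
    | H u =>
      change transportUnitsPf (ContinuousMulEquiv.refl _) (toUnitsPf C u) = toUnitsPf C u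
      rw [transportUnitsPf_mk]
      refine congrArg (toUnitsPf C) (Subtype.ext ?_)
      change transportUnits (ContinuousMulEquiv.refl _) (u : (C.K)ˣ) = (u : (C.K)ˣ)
      exact transportUnits_refl C u
  map_comp {C₁ C₂ C₃} f g := by
    refine TSObj.Hom.ext (MonoidHom.ext fun _ => rfl) (funext fun x => ?_)
    induction x using QuotientGroup.induction_on with
    | H u =>
      change transportUnitsPf ((homIso f).trans (homIso g)) (toUnitsPf C₁ u) =
        transportUnitsPf (homIso g) (transportUnitsPf (homIso f) (toUnitsPf C₁ u))
      rw [transportUnitsPf_mk, transportUnitsPf_mk, transportUnitsPf_mk]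
      refine congrArg (toUnitsPf C₃) (Subtype.ext ?_)
      change transportUnits ((homIso f).trans (homIso g)) (u : (C₁.K)ˣ) =
        transportUnits (homIso g) (transportUnits (homIso f) (u : (C₁.K)ˣ))
      exact transportUnits_trans (homIso f) (homIso g) u

/-- `kbarTimesPf` on objects is `(G_k ↷ (k̄^×)^pf)`. [cite: MochizukiAbsTopIII2015, Prop 5.8 (ii) p. 139] -/
@[simp] theorem kbarTimesPf_obj (C : MonoBase) : kbarTimesPf.obj C = timesPfObj C := rfl

/-- `kbarUnitsPf` on objects is `(G_k ↷ k~)`. [cite: MochizukiAbsTopIII2015, Prop 5.8 (ii) p. 139] -/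
@[simp] theorem kbarUnitsPf_obj (C : MonoBase) : kbarUnitsPf.obj C = unitsPfObj C := rfl

/-- `kbarTimesPf` on a morphism: the Galois component IS `α`. [cite: MochizukiAbsTopIII2015, Prop 5.8 (vii) p.141] -/
theorem kbarTimesPf_map_homPi_apply {C₁ C₂ : MonoBase} (f : C₁ ⟶ C₂) (g : C₁.K ≃ₐ[C₁.k] C₁.K) :
    (kbarTimesPf.map f).homPi g = homIso f g := rfl

/-- `kbarUnitsPf` on a morphism: the Galois component IS `α`. [cite: MochizukiAbsTopIII2015, Prop 5.8 (vii) p.141] -/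
theorem kbarUnitsPf_map_homPi_apply {C₁ C₂ : MonoBase} (f : C₁ ⟶ C₂) (g : C₁.K ≃ₐ[C₁.k] C₁.K) :
    (kbarUnitsPf.map f).homPi g = homIso f g := rfl

/-- `kbarTimesPf` on a morphism: the arithmetic component is `β_α mod μ`. [cite: MochizukiAbsTopIII2015, Prop 5.8 (vii) p.141] -/
theorem kbarTimesPf_map_homM_mk {C₁ C₂ : MonoBase} (f : C₁ ⟶ C₂) (u : (C₁.K)ˣ) :
    (kbarTimesPf.map f).homM (show (timesPfObj C₁).pair.M from toTimesPf C₁ u) =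
      (show (timesPfObj C₂).pair.M from toTimesPf C₂ (transportUnits (homIso f) u)) := rfl

/-- `kbarUnitsPf` on a morphism: the arithmetic component is `β_α mod μ`. [cite: MochizukiAbsTopIII2015, Prop 5.8 (vii) p.141] -/
theorem kbarUnitsPf_map_homM_mk {C₁ C₂ : MonoBase} (f : C₁ ⟶ C₂) (u : ↥(unitGroup C₁.k C₁.K)) :
    (kbarUnitsPf.map f).homM (show (unitsPfObj C₁).pair.M from toUnitsPf C₁ u) =
      (show (unitsPfObj C₂).pair.M from toUnitsPf C₂ (transportUnitGroup (homIso f) u)) := rfl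

/-! ## Part 6. The three remaining edges of `Γ⃗×_non(G)` at container level, natural on the mono-analytic base -/

/-- An element of `𝒪^×_k̄` (abc-iut-w6-d036's carrier `↥(unitSubmonoid k K)`) as an element of abc-iut-L6-d2's `unitGroup`.
[cite: MochizukiAbsTopIII2015, Definition 3.1 (i) p.66] -/
def unitGroupOfUnits (C : MLFClosure.{0}) (x : ↥(unitSubmonoid C.k C.K)) : ↥(unitGroup C.k C.K) :=
  ⟨Units.mk0 (x : C.K) (AbsoluteAnabelian.ne_zero_of_mem_unitSubmonoid x.2), x.2⟩

/-- `unitGroupOfUnits` on values. [cite: MochizukiAbsTopIII2015, Definition 3.1 (i) p.66] -/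
@[simp] theorem coe_unitGroupOfUnits (C : MLFClosure.{0}) (x : ↥(unitSubmonoid C.k C.K)) :
    (((unitGroupOfUnits C x : ↥(unitGroup C.k C.K)) : (C.K)ˣ) : C.K) = x := rfl

/-- **The edge `k̄^×(G) → (k̄^×(G))^pf` of `Γ⃗×_non(G)` is NATURAL on the mono-analytic base** (`ι^{An⊢⊞}_{w,ε}` of Prop 5.8
(vii) along that edge, container level): the quotient map, identity on `G_k`; naturality in an arbitrary isomorphism of
topological Galois groups `α` = `β_α` descends to the torsion quotients. [cite: MochizukiAbsTopIII2015, Prop 5.8 (vii) p.142] -/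
def kbarTimesToTimesPf : kbarTimes ⟶ kbarTimesPf where
  app C := homOfEquivariant (timesObj_actionKer C) (timesPfObj_actionKer C) (timesObj_discreteTopology C)
    (ContinuousMulEquiv.refl _) (fun x => toTimesPf C (unitsOfNonZero C x)) fun _ _ =>
      congrArg (toTimesPf C) (Units.ext rfl)
  naturality _ C₂ _ := TSObj.Hom.ext (MonoidHom.ext fun _ => rfl)
    (funext fun _ => congrArg (toTimesPf C₂) (Units.ext rfl))

/-- **The shell-edge `𝒪^×_k̄(G) → k~(G)` of `Γ⃗×_non(G)` on the mono-analytic side, NATURAL on the base**: the quotient map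
`𝒪^× → 𝒪^× ⧸ μ = (𝒪^×)^pf`. [cite: MochizukiAbsTopIII2015, Prop 5.8 (vii) p.142] -/
def kbarUnitsToUnitsPf : kbarUnits ⟶ kbarUnitsPf where
  app C := homOfEquivariant (unitsObj_actionKer C) (unitsPfObj_actionKer C) (unitsObj_discreteTopology C)
    (ContinuousMulEquiv.refl _) (fun x => toUnitsPf C (unitGroupOfUnits C x)) fun _ _ =>
      congrArg (toUnitsPf C) (Subtype.ext (Units.ext rfl))
  naturality _ C₂ _ := TSObj.Hom.ext (MonoidHom.ext fun _ => rfl)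
    (funext fun _ => congrArg (toUnitsPf C₂) (Subtype.ext (Units.ext rfl)))

/-- **The edge `k~(G) ↪ (k̄^×(G))^pf` of `Γ⃗×_non(G)`, NATURAL on the base**: induced by `𝒪^× ↪ k̄^×` on the torsion quotients.
[cite: MochizukiAbsTopIII2015, Prop 5.8 (vii) p.142] -/
def kbarUnitsPfToTimesPf : kbarUnitsPf ⟶ kbarTimesPf where
  app C := homOfEquivariant (unitsPfObj_actionKer C) (timesPfObj_actionKer C) (unitsPfObj_discreteTopology C)
    (ContinuousMulEquiv.refl _)
    (QuotientGroup.map _ _ (unitGroup C.k C.K).subtype (torsion_le_comap_of_monoidHom _)) fun g x => by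
      induction x using QuotientGroup.induction_on with
      | H u => rfl
  naturality C₁ C₂ f := by
    refine TSObj.Hom.ext (MonoidHom.ext fun _ => rfl) (funext fun x => ?_)
    induction x using QuotientGroup.induction_on with
    | H u => rfl

/-- `kbarTimesToTimesPf` on data: `x ↦ [x]`. [cite: MochizukiAbsTopIII2015, Prop 5.8 (vii) p.142] -/
@[simp] theorem kbarTimesToTimesPf_app_homM (C : MonoBase) (x : ↥(C.K)⁰) :
    (kbarTimesToTimesPf.app C).homM (show (timesObj C).pair.M from x) =
      (show (timesPfObj C).pair.M from toTimesPf C (unitsOfNonZero C x)) := rfl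

/-- `kbarUnitsToUnitsPf` on data: `x ↦ [x]`. [cite: MochizukiAbsTopIII2015, Prop 5.8 (vii) p.142] -/
@[simp] theorem kbarUnitsToUnitsPf_app_homM (C : MonoBase) (x : ↥(unitSubmonoid C.k C.K)) :
    (kbarUnitsToUnitsPf.app C).homM (show (unitsObj C).pair.M from x) =
      (show (unitsPfObj C).pair.M from toUnitsPf C (unitGroupOfUnits C x)) := rfl

/-- `kbarUnitsPfToTimesPf` on data: `[u] ↦ [u]`. [cite: MochizukiAbsTopIII2015, Prop 5.8 (vii) p.142] -/
@[simp] theorem kbarUnitsPfToTimesPf_app_homM_mk (C : MonoBase) (u : ↥(unitGroup C.k C.K)) :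
    (kbarUnitsPfToTimesPf.app C).homM (show (unitsPfObj C).pair.M from toUnitsPf C u) =
      (show (timesPfObj C).pair.M from toTimesPf C (u : (C.K)ˣ)) := rfl

/-- The Galois components of the three edges are identities (they lie over the base ON THE NOSE).
[cite: MochizukiAbsTopIII2015, Prop 5.8 (vii) p.142] -/
theorem pf_edges_homPi (C : MonoBase) (g : C.K ≃ₐ[C.k] C.K) :
    (kbarTimesToTimesPf.app C).homPi g = g ∧ (kbarUnitsToUnitsPf.app C).homPi g = g ∧
      (kbarUnitsPfToTimesPf.app C).homPi g = g := ⟨rfl, rfl, rfl⟩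

/-- **The square of `Γ⃗×_non(G)` commutes at container level**: `𝒪^× → k~ ↪ (k̄^×)^pf` equals `𝒪^× ↪ k̄^× → (k̄^×)^pf`
(both send `x` to its class). [cite: MochizukiAbsTopIII2015, Definition 5.4 (iii) p.126] -/
theorem kbarUnits_pf_square :
    kbarUnitsToUnitsPf ≫ kbarUnitsPfToTimesPf = kbarUnitsToTimes ≫ kbarTimesToTimesPf := by
  ext C : 2
  exact TSObj.Hom.ext (MonoidHom.ext fun _ => rfl) (funext fun _ => congrArg (toTimesPf C) (Units.ext rfl))

/-- Summary for the Prop 5.8 (vii) bookkeeping: genuine, functorial containers at ALL FOUR vertices of `Γ⃗×_non(G)` on the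
mono-analytic base, all of mono-analytic type, with the three perfection edges natural and the square commuting.
[cite: MochizukiAbsTopIII2015, Prop 5.8 (vii) p.141] -/
theorem exists_genuine_pf_containers :
    ∃ (Upf Tpf : MonoBase ⥤ TSObj) (_ : kbarTimes ⟶ Tpf) (_ : kbarUnits ⟶ Upf) (_ : Upf ⟶ Tpf),
      (∀ C : MonoBase, (Tpf.obj C).actionKer = ⊥ ∧ (Upf.obj C).actionKer = ⊥) ∧
      (∀ C : MonoBase, (Tpf.obj C).pair.M = TimesPf C ∧ (Upf.obj C).pair.M = UnitsPf C) :=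
  ⟨kbarUnitsPf, kbarTimesPf, kbarTimesToTimesPf, kbarUnitsToUnitsPf, kbarUnitsPfToTimesPf,
    fun C => ⟨timesPfObj_actionKer C, unitsPfObj_actionKer C⟩, fun _ => ⟨rfl, rfl⟩⟩

end MLFClosure

end Literature.AnabelianGeometry.AbsoluteAnabelian

end
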